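import Summits.AnomalousDissipation.AnomalousDissipation.Theorems.SolenoidalFractalHomogenisationLagrangianCarrierConstructionLevelField
import Summits.AnomalousDissipation.AnomalousDissipation.Theorems.SolenoidalFractalHomogenisationLagrangianCarrierConstructionTowerWindows
import Summits.AnomalousDissipation.AnomalousDissipation.Theorems.SolenoidalFractalHomogenisationLagrangianCarrierEulerianFlow
import Literature.Analysis.FunctionSpaces.HolderInterpolation
import HarnessLib

/-!
# K3L `LagrangianCarrierConstruction` (stmt-AnomalousDissipation-24913), line `birth`, stub `stub_regularL`: design constants of the lifted
# Eulerian levels — sup `k a_m/(2πN_m)`, gradient `3√3 k a_m`, Hessian `L_W a_m N_m` (helper; `--supports stmt-AnomalousDissipation-24913`)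

Summits-side helper file (everything proved; no definitions, no named facts). The lifted Eulerian level field
`v_m(t, z) = level m t (proj z) = (a_m/N_m) Σⱼ envⱼ(a_m t) layerⱼ(N_m z)` of a fractal carrier datum with design `W` (`level_proj_eq_sum`)
has, uniformly in `t`, operator-norm gradient at most `3√3 k a_m` (`norm_fderiv_level_proj_le`, from `lipschitzWith_lift_level`) and
second derivative at most `L_W · a_m · N_m` for a constant `L_W ≥ 0` depending ONLY on the design `W` (`exists_levelHessianConst`:
the layers of the stretched words are the layers of `W`; `‖D²(c · G(N·))‖ ≤ |c| N² ‖D²G‖`, `norm_iteratedFDeriv_rescale_le`; the layer Hessians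
are bounded by lattice periodicity). These are the three numbers `U, M, L` of the Eulerian flows in the distortion tower of `stub_regularL`
(Armstrong–Vicol, arXiv:2305.05048, §2.2: amplitudes `a_m ε_m`, gradients `a_m`, curvatures `a_m/ε_m`). Infrastructure for route-1's rung leaf
F-D1.A0 (a frontier FORMAL rung); NOT a proof of anomalous dissipation.
-/

set_option linter.dupNamespace false

noncomputable section

namespace Summit.AnomalousDissipation.AnomalousDissipation.Theorems.SolenoidalFractalHomogenisation.LagrangianCarrierConstruction

open Set Function Filter Topology Metric
open scoped NNReal ContDiff
open Literature.Analysis Literature.Analysis.FunctionSpaces Literature.Analysis.FunctionSpaces.Torus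
open Literature.Analysis.FluidPDE Literature.Analysis.FluidPDE.LatticeShear
open Summit.AnomalousDissipation.AnomalousDissipation.Theorems.SolenoidalFractalHomogenisation.PermissibleCarrier
  (isSmooth_layer_nsmul abs_trapezoid_le_one)
open Summit.AnomalousDissipation.AnomalousDissipation.Theorems.SolenoidalFractalHomogenisation.LagrangianCarrier
  (lipschitzWith_lift_level)

variable {k : ℕ}

/-- The covering map commutes with natural multiples: `proj (n • z) = n • proj z`. [folklore] -/
theorem proj_nsmul (n : ℕ) (z : EuclideanSpace ℝ (Fin 3)) : proj (n • z) = n • proj z := by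
  induction n with
  | zero => rw [zero_nsmul, zero_nsmul, proj_zero]
  | succ n ih => rw [succ_nsmul, succ_nsmul, proj_add, ih]

/-- Stretching a word in time does not change its layers. [folklore] -/
theorem stretch_phase_layer (W : LatticeWord k) (s : ℝ) (hs : 0 < s) (j : Fin k) :
    ((W.stretch s hs).phase j).layer = (W.phase j).layer := rfl

/-- The layers of the level-`m` word of a datum are the layers of its design. [folklore] -/
theorem word_phase_layer (D : FractalCarrierData k) (m : ℕ) (j : Fin k) :
    ((D.word m).phase j).layer = (D.design.phase j).layer := rfl

/-- A continuous lattice-periodic function has bounded iterated derivatives of every order at which it is smooth: here, the Hessian of a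
smooth lift is bounded. [folklore] -/
theorem exists_bound_iteratedFDeriv_two_lift {F : Type*} [NormedAddCommGroup F] [NormedSpace ℝ F]
    (f : UnitAddTorus (Fin 3) → F) (hf : IsSmooth f) :
    ∃ C : ℝ, 0 ≤ C ∧ ∀ y, ‖iteratedFDeriv ℝ 2 (lift f) y‖ ≤ C := by
  have hper : Torus.IsLatticePeriodic (iteratedFDeriv ℝ 2 (lift f)) := by
    intro j y
    rw [← iteratedFDeriv_comp_add_right]
    congr 1
    funext x
    exact isLatticePeriodic_lift f j x
  have hc : Continuous (iteratedFDeriv ℝ 2 (lift f)) :=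
    hf.continuous_iteratedFDeriv (m := 2) (WithTop.coe_le_coe.2 le_top)
  obtain ⟨C, hC⟩ := exists_bound_of_isLatticePeriodic hper hc
  exact ⟨max C 0, le_max_right _ _, fun y => (hC y).trans (le_max_left _ _)⟩

/-- **Gradient of the lifted level**: `‖D v_m(t)(z)‖ ≤ 3√3 k a_m`. [cite: ArmstrongVicol2025, §2.2 (PDF p. 18: ∇ of the level shears ∼ a_m)] -/
theorem norm_fderiv_level_proj_le (D : FractalCarrierData k) (m : ℕ) (t : ℝ) (z : EuclideanSpace ℝ (Fin 3)) :
    ‖fderiv ℝ (fun z : EuclideanSpace ℝ (Fin 3) => D.level m t (proj z)) z‖ ≤ Real.sqrt 3 * (3 * (k * D.a m)) := by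
  have h := norm_fderiv_le_of_lipschitz ℝ (lipschitzWith_lift_level D m t) (x₀ := z)
  refine h.trans (le_of_eq ?_)
  push_cast
  rfl

/-- **Design Hessian constant.** For every word design `W` there is `L ≥ 0` such that for EVERY fractal carrier datum with design `W`,
every level `m`, time `t` and point `z`: `‖D² v_m(t)(z)‖ ≤ L · a_m · N_m`.
[cite: ArmstrongVicol2025, §2.2 (PDF p. 18: second derivatives of the level shears ∼ a_m/ε_m)] -/
theorem exists_levelHessianConst (W : LatticeWord k) :
    ∃ L : ℝ, 0 ≤ L ∧ ∀ D : FractalCarrierData k, D.design = W → ∀ (m : ℕ) (t : ℝ) (z : EuclideanSpace ℝ (Fin 3)),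
      ‖iteratedFDeriv ℝ 2 (fun z : EuclideanSpace ℝ (Fin 3) => D.level m t (proj z)) z‖ ≤ L * D.a m * D.N m := by
  -- the Hessian bounds of the layers of `W`
  have hsm : ∀ j : Fin k, IsSmooth (W.phase j).layer := fun j => by
    have h := isSmooth_layer_nsmul (W.phase j) 1
    simp only [one_nsmul] at h
    exact h
  choose ℓ hℓ0 hℓ using fun j => exists_bound_iteratedFDeriv_two_lift (W.phase j).layer (hsm j)
  refine ⟨∑ j, ℓ j, Finset.sum_nonneg fun j _ => hℓ0 j, fun D hD m t z => ?_⟩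
  have hN : (0 : ℝ) < D.N m := by exact_mod_cast D.N_pos m
  have ha := D.a_pos m
  -- the explicit form of the lifted level: `(a/N) • Σ_j c_j • G_j (N • z)` with `G_j = lift layer_j`
  set c : Fin k → ℝ := fun j => LatticeWord.trapezoid ((D.word m).start j) ((D.word m).phase j).τ (D.word m).ramp
    (Int.fract (D.a m * t / (D.word m).period) * (D.word m).period) with hc
  set G : Fin k → EuclideanSpace ℝ (Fin 3) → EuclideanSpace ℝ (Fin 3) := fun j => lift (W.phase j).layer with hG
  have hGs : ∀ j, ContDiff ℝ 2 (G j) := fun j => (hsm j).of_le (WithTop.coe_le_coe.2 le_top)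
  have hfun : (fun z : EuclideanSpace ℝ (Fin 3) => D.level m t (proj z)) =
      fun z => (D.a m / (D.N m : ℝ)) • ∑ j, c j • G j ((D.N m : ℝ) • z - 0) := by
    funext z
    rw [level_proj_eq_sum]
    congr 1
    refine Finset.sum_congr rfl fun j _ => ?_
    rw [word_phase_layer, hD]
    simp only [hc, hG, sub_zero, lift_apply, Nat.cast_smul_eq_nsmul, proj_nsmul]
  have hterm : ∀ j, ContDiff ℝ 2 fun z : EuclideanSpace ℝ (Fin 3) => c j • G j ((D.N m : ℝ) • z - 0) := fun j =>
    ((hGs j).comp ((contDiff_const_smul _).sub contDiff_const)).const_smul _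
  have hsum : ContDiff ℝ 2 fun z : EuclideanSpace ℝ (Fin 3) => ∑ j, c j • G j ((D.N m : ℝ) • z - 0) :=
    ContDiff.sum fun j _ => hterm j
  rw [hfun]
  rw [iteratedFDeriv_const_smul_apply' hsum.contDiffAt, norm_smul]
  have hsum' : (fun z : EuclideanSpace ℝ (Fin 3) => ∑ j, c j • G j ((D.N m : ℝ) • z - 0)) =
      ∑ j, fun z : EuclideanSpace ℝ (Fin 3) => c j • G j ((D.N m : ℝ) • z - 0) := by
    funext z; simp only [Finset.sum_apply]
  rw [hsum', iteratedFDeriv_sum_apply fun j _ => (hterm j).contDiffAt]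
  have hbd : ∀ j, ‖iteratedFDeriv ℝ 2 (fun z : EuclideanSpace ℝ (Fin 3) => c j • G j ((D.N m : ℝ) • z - 0)) z‖ ≤
      (D.N m : ℝ) ^ 2 * ℓ j := by
    intro j
    refine (norm_iteratedFDeriv_rescale_le (hGs j) (c j) (D.N m : ℝ) 0 le_rfl z).trans ?_
    rw [abs_of_pos hN]
    calc |c j| * (D.N m : ℝ) ^ 2 * ‖iteratedFDeriv ℝ 2 (G j) ((D.N m : ℝ) • z - 0)‖
        ≤ 1 * (D.N m : ℝ) ^ 2 * ℓ j :=
          mul_le_mul (mul_le_mul_of_nonneg_right (abs_trapezoid_le_one _ _ _ _) (sq_nonneg _)) (hℓ j _) (norm_nonneg _)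
            (by positivity)
      _ = (D.N m : ℝ) ^ 2 * ℓ j := by ring
  calc ‖D.a m / (D.N m : ℝ)‖ * ‖∑ j, iteratedFDeriv ℝ 2 (fun z : EuclideanSpace ℝ (Fin 3) => c j • G j ((D.N m : ℝ) • z - 0)) z‖
      ≤ (D.a m / D.N m) * ∑ j, (D.N m : ℝ) ^ 2 * ℓ j := by
        rw [Real.norm_eq_abs, abs_of_pos (div_pos ha hN)]
        exact mul_le_mul_of_nonneg_left ((norm_sum_le _ _).trans (Finset.sum_le_sum fun j _ => hbd j)) (div_pos ha hN).le
    _ = (∑ j, ℓ j) * D.a m * D.N m := by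
        rw [← Finset.mul_sum]
        field_simp

end Summit.AnomalousDissipation.AnomalousDissipation.Theorems.SolenoidalFractalHomogenisation.LagrangianCarrierConstruction

end
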